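import Mathlib.AlgebraicGeometry.EllipticCurve.Affine.Point
import Mathlib.FieldTheory.IsAlgClosed.AlgebraicClosure
import Mathlib.GroupTheory.OrderOfElement
import Summits.PneNP.PneNP.Theses.EcdlpDefinability

/-!
# Route EcdlpDefinability — `PolynomialLogDegreeBound` (stmt-PneNP-2076)

Lange–Winterhof-type base rung: for an elliptic `W/𝔽_p`, a point `P` of order `N` and `F ∈ 𝔽_p[X]`, the number of
`0 < t < N/2` with `F(x(tP)) = t` and `F(x(2tP)) = 2t` is `≤ 4 deg F + 2`.

Proof: `x(2R) = φ₂(x(R)) / Ψ(x(R))` with `φ₂ = X⁴ - b₄X² - 2b₆X - b₈`, `Ψ = 4X³ + b₂X² + 2b₄X + b₆ = ψ₂²`, valid when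
`2R ≠ O` (`Ψ(x(R)) = (2y + a₁x + a₃)² ≠ 0`); so every good `t` makes `x(tP)` a root of
`G = Σ_k f_k φ₂^k Ψ^{d-k} - 2 F Ψ^d` (`d = deg F ≥ 1`), a polynomial of degree `≤ 4d` which is NON-ZERO: at a root `α`
of `Ψ` in the algebraic closure, `φ₂(α) = N(α, β)²` for a point `(α, β)` of the curve with `2β + a₁α + a₃ = 0`, and
`N(α, β) = 3α² + 2a₂α + a₄ - a₁β ≠ 0` by NONSINGULARITY (`Δ ≠ 0`); if `Ψ` is constant it is a non-zero constant and the
`X^{4d}`-coefficient of `G` is `f_d`. The abscissae `x(tP)`, `0 < t < N/2`, are pairwise distinct. Constant `F` forces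
`t ≡ 0 (mod p)` with `0 < t`, `2t < N ≤ #E(𝔽_p) ≤ 2p + 1`, i.e. `t = p`.
-/

set_option linter.dupNamespace false -- `Summit.PneNP.PneNP.…`: summit = sub-problem name (D-0017 single-conjunct layout)

namespace Summit.PneNP.PneNP.Theorems

open Polynomial

section Field

variable {F : Type} [Field F]

/-- `Ψ(x) = (2y + a₁x + a₃)²` on the curve. [cite: SilvermanAEC2009, III.2.3(d)] [folklore] -/
theorem ecdlp_eval_Psi (W : WeierstrassCurve.Affine F) {x y : F} (h : W.Equation x y) :
    (C 4 * X ^ 3 + C W.b₂ * X ^ 2 + C (2 * W.b₄) * X + C W.b₆ : F[X]).eval x = (2 * y + W.a₁ * x + W.a₃) ^ 2 := by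
  rw [WeierstrassCurve.Affine.equation_iff] at h
  simp only [eval_add, eval_mul, eval_C, eval_pow, eval_X, WeierstrassCurve.b₂, WeierstrassCurve.b₄,
    WeierstrassCurve.b₆]
  linear_combination (-4 : F) * h

/-- The duplication numerator: `φ₂(x) = N² + a₁ N D - (a₂ + 2x) D²` on the curve, `N = 3x² + 2a₂x + a₄ - a₁y`,
`D = 2y + a₁x + a₃`. [cite: SilvermanAEC2009, III.2.3(d)] [folklore] -/
theorem ecdlp_eval_phi (W : WeierstrassCurve.Affine F) {x y : F} (h : W.Equation x y) :
    (X ^ 4 - C W.b₄ * X ^ 2 - C (2 * W.b₆) * X - C W.b₈ : F[X]).eval x =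
      (3 * x ^ 2 + 2 * W.a₂ * x + W.a₄ - W.a₁ * y) ^ 2 +
        W.a₁ * (3 * x ^ 2 + 2 * W.a₂ * x + W.a₄ - W.a₁ * y) * (2 * y + W.a₁ * x + W.a₃) -
        (W.a₂ + 2 * x) * (2 * y + W.a₁ * x + W.a₃) ^ 2 := by
  rw [WeierstrassCurve.Affine.equation_iff] at h
  simp only [eval_sub, eval_mul, eval_C, eval_pow, eval_X, WeierstrassCurve.b₄, WeierstrassCurve.b₆,
    WeierstrassCurve.b₈]
  linear_combination (8 * x + W.a₁ ^ 2 + 4 * W.a₂) * h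

/-- **Doubling in `x`**: for a non-`2`-torsion affine point `(x, y)`, `2(x, y) = (x₂, y₂)` with
`x₂ · (2y + a₁x + a₃)² = φ₂(x)`. [cite: SilvermanAEC2009, III.2.3(d)] [folklore] -/
theorem ecdlp_two_smul_some [DecidableEq F] (W : WeierstrassCurve.Affine F) {x y : F} (h : W.Nonsingular x y)
    (hy : y ≠ W.negY x y) :
    ∃ (x₂ y₂ : F) (h₂ : W.Nonsingular x₂ y₂),
      (WeierstrassCurve.Affine.Point.some x y h : W.Point) + WeierstrassCurve.Affine.Point.some x y h =
          WeierstrassCurve.Affine.Point.some x₂ y₂ h₂ ∧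
        x₂ * (2 * y + W.a₁ * x + W.a₃) ^ 2 = (X ^ 4 - C W.b₄ * X ^ 2 - C (2 * W.b₆) * X - C W.b₈ : F[X]).eval x := by
  refine ⟨_, _, _, WeierstrassCurve.Affine.Point.add_self_of_Y_ne hy, ?_⟩
  have hD : y - W.negY x y = 2 * y + W.a₁ * x + W.a₃ := by
    simp only [WeierstrassCurve.Affine.negY]; ring
  have hD0 : 2 * y + W.a₁ * x + W.a₃ ≠ 0 := by
    rw [← hD]; exact sub_ne_zero.2 hy
  have hl : W.slope x x y y * (2 * y + W.a₁ * x + W.a₃) = 3 * x ^ 2 + 2 * W.a₂ * x + W.a₄ - W.a₁ * y := by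
    rw [WeierstrassCurve.Affine.slope_of_Y_ne rfl hy, hD]
    exact div_mul_cancel₀ _ hD0
  rw [ecdlp_eval_phi W h.1, ← hl, WeierstrassCurve.Affine.addX]
  ring

/-- **`φ₂` and `Ψ` are coprime on an elliptic curve**: at a root `α` of `Ψ` in an algebraically closed field, `φ₂(α) ≠ 0`
— `φ₂(α) = N(α, β)²` at a point `(α, β)` of the curve with `2β + a₁α + a₃ = 0`, and `N(α, β) ≠ 0` by nonsingularity.
[cite: SilvermanAEC2009, III.1.4 and Ex. 3.7] [folklore] -/
theorem ecdlp_eval_phi_ne_zero_of_root {K : Type} [Field K] [IsAlgClosed K] (W : WeierstrassCurve.Affine K)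
    [W.IsElliptic] {α : K} (hα : (C 4 * X ^ 3 + C W.b₂ * X ^ 2 + C (2 * W.b₄) * X + C W.b₆ : K[X]).eval α = 0) :
    (X ^ 4 - C W.b₄ * X ^ 2 - C (2 * W.b₆) * X - C W.b₈ : K[X]).eval α ≠ 0 := by
  -- a point `(α, β)` of the curve
  obtain ⟨β, hβ⟩ : ∃ β : K, β ^ 2 + W.a₁ * α * β + W.a₃ * β = α ^ 3 + W.a₂ * α ^ 2 + W.a₄ * α + W.a₆ := by
    have hq : (X ^ 2 + C (W.a₁ * α + W.a₃) * X - C (α ^ 3 + W.a₂ * α ^ 2 + W.a₄ * α + W.a₆) : K[X]).degree ≠ 0 := by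
      have h2 : (X ^ 2 + C (W.a₁ * α + W.a₃) * X - C (α ^ 3 + W.a₂ * α ^ 2 + W.a₄ * α + W.a₆) : K[X]).degree = 2 := by
        compute_degree!
      rw [h2]
      decide
    obtain ⟨β, hβ⟩ := IsAlgClosed.exists_root _ hq
    refine ⟨β, ?_⟩
    have hβ' := hβ.eq_zero
    simp only [eval_add, eval_sub, eval_mul, eval_pow, eval_X, eval_C] at hβ'
    linear_combination hβ'
  have hE : W.Equation α β := (WeierstrassCurve.Affine.equation_iff ..).2 hβ
  have hN : W.Nonsingular α β := W.equation_iff_nonsingular.1 hE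
  have hD : 2 * β + W.a₁ * α + W.a₃ = 0 := by
    have h2 := ecdlp_eval_Psi W hE
    rw [hα] at h2
    exact (pow_eq_zero_iff (n := 2) (by norm_num)).1 h2.symm
  rw [WeierstrassCurve.Affine.nonsingular_iff'] at hN
  have hNx : W.a₁ * β - (3 * α ^ 2 + 2 * W.a₂ * α + W.a₄) ≠ 0 := hN.2.resolve_right (not_not.2 hD)
  have hNx' : 3 * α ^ 2 + 2 * W.a₂ * α + W.a₄ - W.a₁ * β ≠ 0 := fun h0 => hNx (by linear_combination -h0)
  rw [ecdlp_eval_phi W hE, hD]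
  simpa using pow_ne_zero 2 hNx'

/-! ### The auxiliary polynomial `G = Σ_k f_k φ^k Ψ^{d-k} - 2 F Ψ^d` -/

/-- Degree bound `deg G ≤ 4 deg F` when `deg φ ≤ 4`, `deg Ψ ≤ 3`. [folklore] -/
theorem ecdlp_natDegree_G_le (F' φ Ψ : F[X]) (hφ : φ.natDegree ≤ 4) (hΨ : Ψ.natDegree ≤ 3) :
    ((∑ k ∈ Finset.range (F'.natDegree + 1), C (F'.coeff k) * φ ^ k * Ψ ^ (F'.natDegree - k)) -
        C 2 * F' * Ψ ^ F'.natDegree).natDegree ≤ 4 * F'.natDegree := by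
  refine (natDegree_sub_le _ _).trans (max_le ?_ ?_)
  · refine natDegree_sum_le_of_forall_le _ _ fun k hk => ?_
    rw [Finset.mem_range] at hk
    refine (natDegree_mul_le).trans ?_
    have h1 : (C (F'.coeff k) * φ ^ k).natDegree ≤ 4 * k := by
      refine (natDegree_mul_le).trans ?_
      rw [natDegree_C, zero_add]
      exact natDegree_pow_le.trans (by nlinarith)
    have h2 : (Ψ ^ (F'.natDegree - k)).natDegree ≤ 3 * (F'.natDegree - k) :=
      natDegree_pow_le.trans (by nlinarith)
    have h3 : 4 * k + 3 * (F'.natDegree - k) ≤ 4 * F'.natDegree := by omega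
    omega
  · refine (natDegree_mul_le).trans ?_
    have h1 : (C (2 : F) * F').natDegree ≤ F'.natDegree := (natDegree_mul_le).trans (by rw [natDegree_C, zero_add])
    have h2 : (Ψ ^ F'.natDegree).natDegree ≤ 3 * F'.natDegree := natDegree_pow_le.trans (by nlinarith)
    omega

/-- Evaluation: `G(x) = Ψ(x)^d · F(φ(x)/Ψ(x)) - 2 F(x) Ψ(x)^d` when `Ψ(x) ≠ 0`. [folklore] -/
theorem ecdlp_eval_G (F' φ Ψ : F[X]) {x : F} (hx : Ψ.eval x ≠ 0) :
    ((∑ k ∈ Finset.range (F'.natDegree + 1), C (F'.coeff k) * φ ^ k * Ψ ^ (F'.natDegree - k)) -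
        C 2 * F' * Ψ ^ F'.natDegree).eval x =
      Ψ.eval x ^ F'.natDegree * F'.eval (φ.eval x / Ψ.eval x) - 2 * F'.eval x * Ψ.eval x ^ F'.natDegree := by
  rw [eval_sub, eval_mul, eval_mul, eval_C, eval_pow, eval_finsetSum,
    eval_eq_sum_range (p := F') (φ.eval x / Ψ.eval x), Finset.mul_sum]
  congr 1
  refine Finset.sum_congr rfl fun k hk => ?_
  rw [Finset.mem_range] at hk
  rw [eval_mul, eval_mul, eval_C, eval_pow, eval_pow, div_pow, pow_sub₀ _ hx (Nat.le_of_lt_succ hk), div_eq_mul_inv]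
  ring

/-- Non-vanishing, root case: if `Ψ` has a root `α` (in an extension) where `φ` does not vanish and `deg F ≥ 1`,
then `G ≠ 0`. [folklore] -/
theorem ecdlp_G_ne_zero_of_root {K : Type} [Field K] (i : F →+* K) (F' φ Ψ : F[X]) (hd : 0 < F'.natDegree)
    {α : K} (hΨ : Ψ.eval₂ i α = 0) (hφ : φ.eval₂ i α ≠ 0) :
    (∑ k ∈ Finset.range (F'.natDegree + 1), C (F'.coeff k) * φ ^ k * Ψ ^ (F'.natDegree - k)) -
        C 2 * F' * Ψ ^ F'.natDegree ≠ 0 := by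
  intro hG
  have h := congrArg (fun q : F[X] => q.eval₂ i α) hG
  simp only [eval₂_sub, eval₂_mul, eval₂_finsetSum, eval₂_C, eval₂_pow, eval₂_zero] at h
  rw [hΨ, zero_pow hd.ne', mul_zero, sub_zero, Finset.sum_eq_single F'.natDegree] at h
  · rw [Nat.sub_self, pow_zero, mul_one] at h
    refine mul_ne_zero ?_ (pow_ne_zero _ hφ) h
    rw [map_ne_zero i]
    exact mt leadingCoeff_eq_zero.1 (ne_zero_of_natDegree_gt hd)
  · intro k hk hkd
    rw [Finset.mem_range] at hk
    rw [zero_pow (by omega), mul_zero]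
  · intro h'
    exact absurd (Finset.self_mem_range_succ _) h'

/-- Non-vanishing, constant case: if `Ψ = C e` with `e ≠ 0`, `φ` monic of degree `4` and `deg F ≥ 1`, then the
`X^{4d}`-coefficient of `G` is the leading coefficient of `F`, so `G ≠ 0`. [folklore] -/
theorem ecdlp_G_ne_zero_of_const (F' φ Ψ : F[X]) (hd : 0 < F'.natDegree) (hφm : φ.Monic) (hφ : φ.natDegree = 4)
    (hΨ : Ψ.natDegree = 0) :
    (∑ k ∈ Finset.range (F'.natDegree + 1), C (F'.coeff k) * φ ^ k * Ψ ^ (F'.natDegree - k)) -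
        C 2 * F' * Ψ ^ F'.natDegree ≠ 0 := by
  intro hG
  have hφd : (φ ^ F'.natDegree).natDegree = 4 * F'.natDegree := by rw [hφm.natDegree_pow, hφ, mul_comm]
  have hA : (C (F'.coeff F'.natDegree) * φ ^ F'.natDegree * Ψ ^ (F'.natDegree - F'.natDegree)).coeff
      (4 * F'.natDegree) = F'.coeff F'.natDegree := by
    rw [Nat.sub_self, pow_zero, mul_one, coeff_C_mul, ← hφd, (hφm.pow _).coeff_natDegree, mul_one]
  have hB : (C 2 * F' * Ψ ^ F'.natDegree).coeff (4 * F'.natDegree) = 0 := by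
    apply coeff_eq_zero_of_natDegree_lt
    refine (natDegree_mul_le).trans_lt ?_
    have h1 : (C (2 : F) * F').natDegree ≤ F'.natDegree := (natDegree_mul_le).trans (by rw [natDegree_C, zero_add])
    have h2 : (Ψ ^ F'.natDegree).natDegree ≤ 0 := natDegree_pow_le.trans (by rw [hΨ, mul_zero])
    omega
  have hC : ∀ k ∈ Finset.range (F'.natDegree + 1), k ≠ F'.natDegree →
      (C (F'.coeff k) * φ ^ k * Ψ ^ (F'.natDegree - k)).coeff (4 * F'.natDegree) = 0 := by
    intro k hk hkd
    rw [Finset.mem_range] at hk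
    apply coeff_eq_zero_of_natDegree_lt
    refine (natDegree_mul_le).trans_lt ?_
    have h1 : (C (F'.coeff k) * φ ^ k).natDegree ≤ 4 * k := by
      refine (natDegree_mul_le).trans ?_
      rw [natDegree_C, zero_add, hφm.natDegree_pow, hφ, mul_comm]
    have h2 : (Ψ ^ (F'.natDegree - k)).natDegree ≤ 0 := natDegree_pow_le.trans (by rw [hΨ, mul_zero])
    omega
  have h := congrArg (fun q : F[X] => q.coeff (4 * F'.natDegree)) hG
  simp only [coeff_sub, finsetSum_coeff, coeff_zero] at h
  rw [Finset.sum_eq_single F'.natDegree hC (fun h' => absurd (Finset.self_mem_range_succ _) h'), hA, hB,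
    sub_zero] at h
  exact absurd h (mt leadingCoeff_eq_zero.1 (ne_zero_of_natDegree_gt hd))

end Field

/-! ### A crude point count over `𝔽_p`: `#E(𝔽_p) ≤ 2p + 1` -/

/-- The order of a point is at most `2p + 1`: there are at most two ordinates per abscissa. [folklore] -/
theorem ecdlp_addOrderOf_le (p : ℕ) [Fact p.Prime] (W : WeierstrassCurve.Affine (ZMod p)) (P : W.Point) :
    addOrderOf P ≤ 2 * p + 1 := by
  classical
  -- at most `2p` affine solutions
  have hsol : ((Finset.univ : Finset (ZMod p × ZMod p)).filter fun xy => W.Equation xy.1 xy.2).card ≤ 2 * p := by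
    have hfib : ∀ a : ZMod p, (((Finset.univ : Finset (ZMod p × ZMod p)).filter fun xy => W.Equation xy.1 xy.2).filter
        fun xy => xy.1 = a).card ≤ 2 := by
      intro a
      set q : (ZMod p)[X] := X ^ 2 + C (W.a₁ * a + W.a₃) * X - C (a ^ 3 + W.a₂ * a ^ 2 + W.a₄ * a + W.a₆) with hq
      have hqd : q.natDegree = 2 := by rw [hq]; compute_degree!
      have hq0 : q ≠ 0 := fun h0 => by rw [h0, natDegree_zero] at hqd; exact absurd hqd (by norm_num)
      calc _ ≤ q.roots.toFinset.card := by
            refine Finset.card_le_card_of_injOn Prod.snd (fun xy hxy => ?_) (fun xy hxy xy' hxy' h => ?_)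
            · rw [Finset.coe_filter, Set.mem_setOf_eq, Finset.mem_filter] at hxy
              obtain ⟨⟨-, hE⟩, rfl⟩ := hxy
              rw [WeierstrassCurve.Affine.equation_iff] at hE
              rw [Finset.mem_coe, Multiset.mem_toFinset, mem_roots hq0, IsRoot.def]
              simp only [hq, eval_add, eval_sub, eval_mul, eval_pow, eval_X, eval_C]
              linear_combination hE
            · rw [Finset.coe_filter, Set.mem_setOf_eq] at hxy hxy'
              exact Prod.ext (hxy.2.trans hxy'.2.symm) h
        _ ≤ Multiset.card q.roots := Multiset.toFinset_card_le _
        _ ≤ q.natDegree := card_roots' q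
        _ = 2 := hqd
    refine (Finset.card_le_mul_card_image _ 2 fun a _ => hfib a).trans ?_
    have h := Finset.card_le_univ (((Finset.univ : Finset (ZMod p × ZMod p)).filter fun xy => W.Equation xy.1 xy.2).image
      Prod.fst)
    rw [ZMod.card] at h
    omega
  letI : Fintype W.Point :=
    Fintype.ofEquiv (Option {xy : ZMod p × ZMod p // W.Nonsingular xy.1 xy.2}) W.nonsingularPointEquiv.symm
  calc addOrderOf P ≤ Fintype.card W.Point := addOrderOf_le_card_univ
    _ = Fintype.card (Option {xy : ZMod p × ZMod p // W.Nonsingular xy.1 xy.2}) := Fintype.ofEquiv_card _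
    _ = Fintype.card {xy : ZMod p × ZMod p // W.Nonsingular xy.1 xy.2} + 1 := Fintype.card_option
    _ ≤ 2 * p + 1 := by
      rw [Fintype.card_subtype]
      refine Nat.add_le_add_right ((Finset.card_le_card fun xy hxy => ?_).trans hsol) 1
      rw [Finset.mem_filter] at hxy ⊢
      exact ⟨hxy.1, hxy.2.1⟩

/-! ### The bound -/

/-- **stmt-PneNP-2076** `PolynomialLogDegreeBound`: the number of `0 < t < N/2` with `F(x(tP)) = t` and
`F(x(2tP)) = 2t` is at most `4 deg F + 2`. [cite: LangeWinterhof2002] -/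
theorem ecdlpDefinability_polynomialLogDegreeBound_proof :
    Summit.PneNP.PneNP.Theses.EcdlpDefinability.PolynomialLogDegreeBound := by
  intro p hp W hW P F
  classical
  -- the duplication polynomials
  set Ψ : (ZMod p)[X] := C 4 * X ^ 3 + C W.toAffine.b₂ * X ^ 2 + C (2 * W.toAffine.b₄) * X + C W.toAffine.b₆ with hΨ
  set φ : (ZMod p)[X] := X ^ 4 - C W.toAffine.b₄ * X ^ 2 - C (2 * W.toAffine.b₆) * X - C W.toAffine.b₈ with hφ
  have hφm : φ.Monic := by rw [hφ]; monicity!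
  have hφ4 : φ.natDegree = 4 := by rw [hφ]; compute_degree!
  have hΨ3 : Ψ.natDegree ≤ 3 := by rw [hΨ]; exact natDegree_cubic_le
  -- the data carried by a good `t`
  have key : ∀ t : ℕ,
      (∃ (x y : ZMod p) (h : W.toAffine.Nonsingular x y), t • P = .some x y h ∧ F.eval x = (t : ZMod p)) →
      (∃ (x y : ZMod p) (h : W.toAffine.Nonsingular x y),
          (2 * t) • P = .some x y h ∧ F.eval x = ((2 * t : ℕ) : ZMod p)) →
      ∃ (x y : ZMod p) (h : W.toAffine.Nonsingular x y), t • P = .some x y h ∧ F.eval x = (t : ZMod p) ∧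
        Ψ.eval x ≠ 0 ∧ F.eval (φ.eval x / Ψ.eval x) = 2 * (t : ZMod p) := by
    rintro t ⟨x, y, h, hP, hFx⟩ ⟨x', y', h', hP', hFx'⟩
    refine ⟨x, y, h, hP, hFx, ?_⟩
    rw [two_mul, add_nsmul, hP] at hP'
    have hy : y ≠ W.toAffine.negY x y := by
      intro hy
      rw [WeierstrassCurve.Affine.Point.add_self_of_Y_eq hy] at hP'
      exact WeierstrassCurve.Affine.Point.some_ne_zero h' hP'.symm
    obtain ⟨x₂, y₂, h₂, hadd, hx₂⟩ := ecdlp_two_smul_some W.toAffine h hy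
    rw [hadd] at hP'
    obtain ⟨hxx, -⟩ := WeierstrassCurve.Affine.Point.some.inj hP'
    have hD : y - W.toAffine.negY x y = 2 * y + W.toAffine.a₁ * x + W.toAffine.a₃ := by
      simp only [WeierstrassCurve.Affine.negY]; ring
    have hD0 : 2 * y + W.toAffine.a₁ * x + W.toAffine.a₃ ≠ 0 := by
      rw [← hD]; exact sub_ne_zero.2 hy
    have hΨx : Ψ.eval x = (2 * y + W.toAffine.a₁ * x + W.toAffine.a₃) ^ 2 := ecdlp_eval_Psi W.toAffine h.1
    refine ⟨by rw [hΨx]; exact pow_ne_zero 2 hD0, ?_⟩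
    have hq : φ.eval x / Ψ.eval x = x₂ := by
      rw [hΨx, ← hx₂, mul_div_cancel_right₀ _ (pow_ne_zero 2 hD0)]
    rw [hq, hxx, hFx']
    push_cast
    rfl
  by_cases hd : F.natDegree = 0
  · -- constant `F`: `t ≡ 0 (mod p)`, `0 < t`, `2t < N ≤ 2p + 1`
    have hFC : F = C (F.coeff 0) := eq_C_of_natDegree_eq_zero hd
    have hN : addOrderOf P ≤ 2 * p + 1 := ecdlp_addOrderOf_le p W.toAffine P
    rw [hd, mul_zero, zero_add]
    refine (Finset.card_le_card (t := {p}) fun t ht => ?_).trans (by simp)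
    rw [Finset.mem_filter] at ht
    obtain ⟨-, ht0, h2t, hE1, hE2⟩ := ht
    obtain ⟨x, y, h, -, hFx, -, hF2⟩ := key t hE1 hE2
    rw [hFC, eval_C] at hFx hF2
    have ht : (t : ZMod p) = 0 := by linear_combination hFx - hF2
    rw [ZMod.natCast_eq_zero_iff] at ht
    rw [Finset.mem_singleton]
    have h1 := Nat.le_of_dvd ht0 ht
    omega
  · -- non-constant `F`: the good abscissae are roots of `G ≠ 0`, `deg G ≤ 4 deg F`
    have hd' : 0 < F.natDegree := Nat.pos_of_ne_zero hd
    set G : (ZMod p)[X] := (∑ k ∈ Finset.range (F.natDegree + 1), C (F.coeff k) * φ ^ k * Ψ ^ (F.natDegree - k)) -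
      C 2 * F * Ψ ^ F.natDegree with hG
    have hG0 : G ≠ 0 := by
      by_cases hΨdeg : 0 < Ψ.natDegree
      · -- a root of `Ψ` in the algebraic closure, where `φ` does not vanish
        have i : ZMod p →+* AlgebraicClosure (ZMod p) := algebraMap (ZMod p) (AlgebraicClosure (ZMod p))
        have hdeg : (Ψ.map i).degree ≠ 0 := by
          rw [degree_map]
          exact (natDegree_pos_iff_degree_pos.1 hΨdeg).ne'
        obtain ⟨α, hα⟩ := IsAlgClosed.exists_root _ hdeg
        have hΨ' : Ψ.map i = C 4 * X ^ 3 + C (W.map i).toAffine.b₂ * X ^ 2 + C (2 * (W.map i).toAffine.b₄) * X +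
            C (W.map i).toAffine.b₆ := by
          rw [hΨ]
          simp only [Polynomial.map_add, Polynomial.map_mul, Polynomial.map_pow, Polynomial.map_X, Polynomial.map_C,
            WeierstrassCurve.map_b₂, WeierstrassCurve.map_b₄, WeierstrassCurve.map_b₆]
          rw [map_ofNat i 4, map_mul i, map_ofNat i 2]
        have hφ' : φ.map i = X ^ 4 - C (W.map i).toAffine.b₄ * X ^ 2 - C (2 * (W.map i).toAffine.b₆) * X -
            C (W.map i).toAffine.b₈ := by
          rw [hφ]
          simp only [Polynomial.map_sub, Polynomial.map_mul, Polynomial.map_pow, Polynomial.map_X, Polynomial.map_C,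
            WeierstrassCurve.map_b₄, WeierstrassCurve.map_b₆, WeierstrassCurve.map_b₈]
          rw [map_mul i, map_ofNat i 2]
        have hαΨ : Ψ.eval₂ i α = 0 := by rw [← eval_map]; exact hα
        have hαφ : φ.eval₂ i α ≠ 0 := by
          rw [← eval_map, hφ']
          refine ecdlp_eval_phi_ne_zero_of_root (W.map i).toAffine ?_
          rw [← hΨ', eval_map]
          exact hαΨ
        exact ecdlp_G_ne_zero_of_root i F φ Ψ hd' hαΨ hαφ
      · exact ecdlp_G_ne_zero_of_const F φ Ψ hd' hφm hφ4 (by omega)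
    have hGdeg : G.natDegree ≤ 4 * F.natDegree := ecdlp_natDegree_G_le F φ Ψ hφ4.le hΨ3
    -- the abscissa of `tP`
    let ξ : ℕ → ZMod p := fun t => match t • P with
      | .zero => 0
      | .some x _ _ => x
    have hξ : ∀ (t : ℕ) (x y : ZMod p) (h : W.toAffine.Nonsingular x y), t • P = .some x y h → ξ t = x := by
      intro t x y h ht
      simp only [ξ]
      rw [ht]
    calc _ ≤ G.roots.toFinset.card := by
          refine Finset.card_le_card_of_injOn ξ (fun t ht => ?_) (fun t₁ ht₁ t₂ ht₂ heq => ?_)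
          · -- good abscissae are roots of `G`
            rw [Finset.coe_filter, Set.mem_setOf_eq] at ht
            obtain ⟨-, -, -, hE1, hE2⟩ := ht
            obtain ⟨x, y, h, hP, hFx, hΨx, hF2⟩ := key t hE1 hE2
            rw [Finset.mem_coe, Multiset.mem_toFinset, mem_roots hG0, IsRoot.def, hξ t x y h hP, hG,
              ecdlp_eval_G F φ Ψ hΨx, hF2, hFx]
            ring
          · -- the abscissae `x(tP)`, `0 < t < N/2`, are pairwise distinct
            rw [Finset.coe_filter, Set.mem_setOf_eq, Finset.mem_range] at ht₁ ht₂
            obtain ⟨hlt₁, h0₁, h2₁, ⟨x₁, y₁, h₁, hP₁, -⟩, -⟩ := ht₁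
            obtain ⟨hlt₂, h0₂, h2₂, ⟨x₂, y₂, h₂, hP₂, -⟩, -⟩ := ht₂
            rw [hξ t₁ x₁ y₁ h₁ hP₁, hξ t₂ x₂ y₂ h₂ hP₂] at heq
            rcases (WeierstrassCurve.Affine.Point.X_eq_iff (h₁ := h₁) (h₂ := h₂)).1 heq with hst | hst
            · rw [← hP₁, ← hP₂] at hst
              exact nsmul_injOn_Iio_addOrderOf hlt₁ hlt₂ hst
            · rw [← hP₁, ← hP₂, ← add_eq_zero_iff_eq_neg, ← add_nsmul] at hst
              have hdvd := addOrderOf_dvd_iff_nsmul_eq_zero.2 hst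
              have hle := Nat.le_of_dvd (by omega) hdvd
              omega
      _ ≤ Multiset.card G.roots := Multiset.toFinset_card_le _
      _ ≤ G.natDegree := card_roots' G
      _ ≤ 4 * F.natDegree + 2 := by omega

end Summit.PneNP.PneNP.Theorems
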